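import Summits.QuantumFields.BalabanUV.Beta.MultiscaleDistance
import Summits.QuantumFields.BalabanUV.Beta.MultiscaleCoerciveTorusCov
import Literature.MathematicalPhysics.QuantumLattice.TorusTestPotential
import Literature.MathematicalPhysics.QuantumFieldTheory.Balaban1983to89.B9Thm37GlueTorusCovCT

/-!
# Beta / MultiscaleDecayBudget — NODE (w2′) OF THE O.2 SKELETON §8.5, FILE 1 OF 2: THE TWO SITEWISE BUDGETS OF THE MULTI-REGION
# AVERAGED OPERATOR ON THE TORUS ON THE LOCAL SCALE `n(x)⁻²` (MODEL; the DECAY half of O.2 item (v) «k-UNIFORM constants»)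

Setting: pv21's torus `UT N`, a pairwise-disjoint COVERING family of cubes (cell `k`: level `l_k`, side `S_{l_k}`, corner `zc k`), the
site scale `n(x) := S_{l_k}` for `x ∈ cell k`, and the scale-adapted distance `d_n` of (K) `MultiscaleDistance` (bond length
`min(1/n(x), 1/n(y))`).  For the Combes–Thomas weight `φ = κ·d_n(·, y)` the two error parts of (J′)
`MultiscaleConjError.conjErr_levelOp_ge_local_cosh` are bounded ON THE LOCAL SCALE: the bond part by `2d·c_max²·κ²·Σ_x n(x)⁻²F(x)`
(`κ ≤ 1`; second order), the averaging part — level weights `ω_l` supported on the family's level-`l` cells ((3.24)'s `Σ_{y∈Λ_j}`) and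
print-size from above, `a_lω_l²S_l^d ≤ a_max/S_l²` — by `a_max·(e^{2dκ} − 1)·Σ_x n(x)⁻²F(x)`: constants seeing `d, c, a` only, neither
the sides nor the levels nor their number nor the volume.  File 2 (`MultiscaleDecay`) feeds these into the row owner's site-local END
(unit `b2b-balaban-beta-d4-p2`, GEN 8, MODEL crew; claim «MULTISCALE-DECAY-MODEL» journal l.18614, part (L); over (K) p229994, (J′) p230159,
(D) `MultiscaleCoerciveTorus` p226960, pv21 `B9Thm37GlueTorusCov*` BY NAME).

HONEST FRAMING: discharging `BetaPertH` makes Bałaban's UV stability UNCONDITIONAL — NOT the continuum limit, NOT the Clay problem.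
HONEST DEPENDENCY (verbatim): «continuum YM on T⁴ ⇐ BetaPertH ∧ nine spine estimates (0/9 proved); BetaPertH ⇐ (D1) ∧ (D4) ∧ CAP+tail;
G-an2-4 gates asym, D1 and NE2/3/4.»  THIS MODULE DISCHARGES NOTHING of `BetaPertH`, asserts NOTHING printed and cites nothing as a fact
(ABSOLUTE RULE): [folklore] lattice bookkeeping about the pv21∕b05 torus MODEL (cube cells `cellPt`, corner labels `ctrU ∘ tblk`, bonds
`(x, μ)`, the cube comb `torusComb`); the weights `ω`, coefficients `a`, `c` and the cell family are DATA.  NOT modelled: Dirichlet holes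
`Ω₀`, print's region geometry ([B6] (2.1)–(2.2)), Bałaban's own `U_k`, `Ū^l`, the vector operators.  LOCI (shape only): [B9] =
`Balaban1985BackgroundPropagators` (3.24) p. 394, Thm 3.1 (3.42) p. 397; [B6] = `Balaban1984PropagatorsII` (2.46) p. 231.  No class change
on row D4 (critical-path width 0; D4 DISCHARGE NO DATE); NOT BetaPertH, NOT continuum, NOT Clay, NOT summit progress.

CONTENT (kernel, 0 sorry).  §1 covering cube families: `cellOf`, the site scale **`siteScale`** (`= S_{l_k}` on cell `k`), cell sums =
scaled site sums (`sum_cells_eq_sum_sites`, **`sum_cells_scale_eq`** — turns the cell-sum coercivity of (D)∕(H) into the SITEWISE profile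
`C·n(x)⁻²`).  §2 **`bond_budget_le`**: `Σ_b c_b²(cosh(κ·slen_b) − 1)(F(b₊) + F(b₋)) ≤ 2d·c_max²κ²·Σ_x n(x)⁻²F(x)` (`cosh u − 1 ≤ u²`,
`QuantumLattice.cosh_sub_one_le_sq_of_abs_le_one`; `≤ d` bonds into and out of each site).  §3 `card_block_le` (`≤ S^d` sites per corner-
labelled block) and **`avg_budget_le`**: on a supported block the cube comb gives the oscillation `≤ κ·2d(S − 1)/S ≤ 2dκ`
(`MultiscaleDistance.abs_sdist_sub_sdist_le_of_blk`), every site carries at most ONE supported level, hence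
`Σ_l a_lΣ_β |ω_l(β)|²(e^{Θ_l(β)} − 1)S_l^dΣ_{x∈β}F(x) ≤ a_max(e^{2dκ} − 1)Σ_x n(x)⁻²F(x)` for any budget `Θ` equal to `κ·2d(S_l − 1)/S_l` on the
blocks where the oscillation clause holds.
-/

namespace Summit.QuantumFields.BalabanUV.Beta.MultiscaleDecayBudget

open Finset Function
open Summit.QuantumFields.BalabanUV.Beta.BoxPoincare (Box)
open Summit.QuantumFields.BalabanUV.Beta.CovariantBoxPoincare (hol succ)
open Summit.QuantumFields.BalabanUV.Beta.MultiscaleCoerciveTorus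
open Summit.QuantumFields.BalabanUV.Beta.MultiscaleDistance
open Literature.MathematicalPhysics.QuantumFieldTheory.Balaban1983to89
open Literature.MathematicalPhysics.QuantumFieldTheory.Balaban1983to89.B9Thm37GluePU (bsrc btgt bsrc_apply btgt_apply)
open Literature.MathematicalPhysics.QuantumFieldTheory.Balaban1983to89.B9Thm37GlueTorusCov (tblk torusComb tdepth)
open Literature.MathematicalPhysics.QuantumFieldTheory.Balaban1983to89.B9Thm37GlueTorusCovPoinc (tdepth_le)
open Literature.MathematicalPhysics.QuantumFieldTheory.Balaban1983to89.B9Thm37GlueTorusCovCT (sum_comp_le_of_card_fiber_le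
  card_filter_bsrc_le card_filter_btgt_le)
open B5TorusCover (UT Ctr ctrU)

noncomputable section

variable {d : ℕ} {N : Fin d → ℕ} [∀ i, NeZero (N i)] {Cp J K : Type} [Fintype Cp] [DecidableEq Cp] [Fintype J] [Fintype K]
  (S : J → ℕ) (hS : ∀ l, 1 ≤ S l) (hdivS : ∀ l i, S l ∣ N i) (lvl : K → J) (zc : (k : K) → Ctr N (S (lvl k)))

/-! ## §1 Covering cube families: the cell of a site, the site scale, cell sums as scaled site sums -/

section Cells

/-- The cell containing a site, for a COVERING family (a choice; unique for a disjoint family by `cellOf_cellPt`). [folklore] -/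
def cellOf (hcover : ∀ x : UT N, ∃ k, ∃ v : Box d (S (lvl k)), cellPt S hS hdivS lvl zc k v = x) (x : UT N) : K :=
  Classical.choose (hcover x)

omit [Fintype J] [Fintype K] in
/-- [folklore] -/
theorem cellOf_spec (hcover : ∀ x : UT N, ∃ k, ∃ v : Box d (S (lvl k)), cellPt S hS hdivS lvl zc k v = x) (x : UT N) :
    ∃ v : Box d (S (lvl (cellOf S hS hdivS lvl zc hcover x))), cellPt S hS hdivS lvl zc (cellOf S hS hdivS lvl zc hcover x) v = x :=
  Classical.choose_spec (hcover x)

omit [Fintype J] [Fintype K] in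
/-- For a disjoint family the cell of a chart point is its cell. [folklore] -/
theorem cellOf_cellPt (hdisj : ∀ k k' v v', cellPt S hS hdivS lvl zc k v = cellPt S hS hdivS lvl zc k' v' → k = k')
    (hcover : ∀ x : UT N, ∃ k, ∃ v : Box d (S (lvl k)), cellPt S hS hdivS lvl zc k v = x) (k : K) (v : Box d (S (lvl k))) :
    cellOf S hS hdivS lvl zc hcover (cellPt S hS hdivS lvl zc k v) = k := by
  obtain ⟨w, hw⟩ := cellOf_spec S hS hdivS lvl zc hcover (cellPt S hS hdivS lvl zc k v)
  exact hdisj _ _ _ _ hw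

/-- **The site scale** `n(x)` = the side `S_{l_k}` of the cell `k` containing `x` (MODEL of «`L^jη` for `y ∈ Λ_j`»).
[cite: Balaban1985BackgroundPropagators, Thm 3.1 (3.42) p.397] -/
def siteScale (hcover : ∀ x : UT N, ∃ k, ∃ v : Box d (S (lvl k)), cellPt S hS hdivS lvl zc k v = x) (x : UT N) : ℕ :=
  S (lvl (cellOf S hS hdivS lvl zc hcover x))

omit [Fintype J] [Fintype K] in
/-- [folklore] -/
theorem one_le_siteScale (hcover : ∀ x : UT N, ∃ k, ∃ v : Box d (S (lvl k)), cellPt S hS hdivS lvl zc k v = x) (x : UT N) :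
    1 ≤ siteScale S hS hdivS lvl zc hcover x := hS _

omit [Fintype J] [Fintype K] in
/-- On cell `k` the site scale is `S_{l_k}`. [folklore] -/
theorem siteScale_cellPt (hdisj : ∀ k k' v v', cellPt S hS hdivS lvl zc k v = cellPt S hS hdivS lvl zc k' v' → k = k')
    (hcover : ∀ x : UT N, ∃ k, ∃ v : Box d (S (lvl k)), cellPt S hS hdivS lvl zc k v = x) (k : K) (v : Box d (S (lvl k))) :
    siteScale S hS hdivS lvl zc hcover (cellPt S hS hdivS lvl zc k v) = S (lvl k) := by
  rw [siteScale, cellOf_cellPt S hS hdivS lvl zc hdisj hcover]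

omit [Fintype J] in
/-- **A disjoint covering family is a bijective chart of the torus**: `Σ_k Σ_v G(cellPt k v) = Σ_x G(x)`. [folklore] -/
theorem sum_cells_eq_sum_sites (hdisj : ∀ k k' v v', cellPt S hS hdivS lvl zc k v = cellPt S hS hdivS lvl zc k' v' → k = k')
    (hcover : ∀ x : UT N, ∃ k, ∃ v : Box d (S (lvl k)), cellPt S hS hdivS lvl zc k v = x) (G : UT N → ℝ) :
    ∑ k, ∑ v : Box d (S (lvl k)), G (cellPt S hS hdivS lvl zc k v) = ∑ x, G x := by
  have hbij : Bijective (fun p : (Σ k, Box d (S (lvl k))) => cellPt S hS hdivS lvl zc p.1 p.2) :=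
    ⟨sigma_injective S hS hdivS lvl zc hdisj, fun x => by
      obtain ⟨k, v, h⟩ := hcover x
      exact ⟨⟨k, v⟩, h⟩⟩
  calc ∑ k, ∑ v : Box d (S (lvl k)), G (cellPt S hS hdivS lvl zc k v)
      = ∑ p : (Σ k, Box d (S (lvl k))), G (cellPt S hS hdivS lvl zc p.1 p.2) := by
        rw [← Finset.univ_sigma_univ, Finset.sum_sigma]
    _ = ∑ x, G x := Fintype.sum_bijective _ hbij _ _ fun p => rfl

omit [Fintype J] in
/-- **Cell sums with the weights `S_{l_k}⁻²` are site sums with the weights `n(x)⁻²`.** [folklore] -/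
theorem sum_cells_scale_eq (hdisj : ∀ k k' v v', cellPt S hS hdivS lvl zc k v = cellPt S hS hdivS lvl zc k' v' → k = k')
    (hcover : ∀ x : UT N, ∃ k, ∃ v : Box d (S (lvl k)), cellPt S hS hdivS lvl zc k v = x) (F : UT N → ℝ) :
    ∑ k, ((S (lvl k) : ℝ) ^ 2)⁻¹ * ∑ v : Box d (S (lvl k)), F (cellPt S hS hdivS lvl zc k v) =
      ∑ x, ((siteScale S hS hdivS lvl zc hcover x : ℝ) ^ 2)⁻¹ * F x := by
  rw [← sum_cells_eq_sum_sites S hS hdivS lvl zc hdisj hcover]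
  refine Finset.sum_congr rfl fun k _ => ?_
  rw [Finset.mul_sum]
  refine Finset.sum_congr rfl fun v _ => ?_
  rw [siteScale_cellPt S hS hdivS lvl zc hdisj hcover]

end Cells

/-! ## §2 The bond budget on the local scale -/

section Bond

variable {n : UT N → ℕ}

omit [∀ i, NeZero (N i)] [Fintype J] [Fintype K] in
/-- `0 ≤ κ ≤ 1`, scales `≥ 1`: `cosh(κ·slen(x,z)) − 1 ≤ κ²·n(z)⁻²` (and symmetrically `≤ κ²·n(x)⁻²`). [folklore] -/
theorem cosh_step_sub_one_le (hn : ∀ x, 1 ≤ n x) {κ : ℝ} (hκ0 : 0 ≤ κ) (hκ1 : κ ≤ 1) (x z : UT N) :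
    Real.cosh (κ * slen n x z) - 1 ≤ κ ^ 2 * ((n z : ℝ) ^ 2)⁻¹ := by
  have hs0 : 0 ≤ slen n x z := slen_nonneg n x z
  have hs1 : slen n x z ≤ 1 := slen_le_one n hn x z
  have hsz : slen n x z ≤ (n z : ℝ)⁻¹ := slen_le_right n x z
  have habs : |κ * slen n x z| ≤ 1 := by
    rw [abs_of_nonneg (mul_nonneg hκ0 hs0)]
    calc κ * slen n x z ≤ 1 * 1 := mul_le_mul hκ1 hs1 hs0 zero_le_one
      _ = 1 := one_mul 1
  calc Real.cosh (κ * slen n x z) - 1 ≤ (κ * slen n x z) ^ 2 :=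
        Literature.MathematicalPhysics.QuantumLattice.cosh_sub_one_le_sq_of_abs_le_one habs
    _ = κ ^ 2 * slen n x z ^ 2 := by ring
    _ ≤ κ ^ 2 * ((n z : ℝ) ^ 2)⁻¹ := by
        rw [← inv_pow]
        exact mul_le_mul_of_nonneg_left (pow_le_pow_left₀ hs0 hsz 2) (sq_nonneg κ)

omit [Fintype J] [Fintype K] in
/-- **THE BOND BUDGET**: with `θ_b = κ·slen(b₋, b₊)`, `0 ≤ κ ≤ 1`, `|c| ≤ c_max`, `F ≥ 0`:
`Σ_b c_b²(cosh θ_b − 1)(F(b₊) + F(b₋)) ≤ 2d·c_max²·κ²·Σ_x n(x)⁻²F(x)` — SECOND order in `κ` and on the local scale `n⁻²` (each site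
is the source of `≤ d` and the target of `≤ d` torus bonds). [cite: Balaban1985BackgroundPropagators, Thm 3.1 (3.42) p.397] -/
theorem bond_budget_le (hn : ∀ x, 1 ≤ n x) (c : UT N × Fin d → ℝ) {cmax : ℝ} (hc : ∀ b, |c b| ≤ cmax) {κ : ℝ} (hκ0 : 0 ≤ κ)
    (hκ1 : κ ≤ 1) (F : UT N → ℝ) (hF : ∀ x, 0 ≤ F x) :
    ∑ b, c b ^ 2 * (Real.cosh (κ * slen n (bsrc b) (btgt b)) - 1) * (F (btgt b) + F (bsrc b)) ≤
      2 * d * cmax ^ 2 * κ ^ 2 * ∑ x, ((n x : ℝ) ^ 2)⁻¹ * F x := by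
  set H : UT N → ℝ := fun x => ((n x : ℝ) ^ 2)⁻¹ * F x with hH
  have hH0 : ∀ x, 0 ≤ H x := fun x => mul_nonneg (inv_nonneg.mpr (sq_nonneg _)) (hF x)
  have hc2 : ∀ b, c b ^ 2 ≤ cmax ^ 2 := fun b => by
    rw [← sq_abs (c b)]; exact pow_le_pow_left₀ (abs_nonneg _) (hc b) 2
  have hterm : ∀ b : UT N × Fin d, c b ^ 2 * (Real.cosh (κ * slen n (bsrc b) (btgt b)) - 1) * (F (btgt b) + F (bsrc b)) ≤
      cmax ^ 2 * κ ^ 2 * (H (btgt b) + H (bsrc b)) := by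
    intro b
    have hch0 : 0 ≤ Real.cosh (κ * slen n (bsrc b) (btgt b)) - 1 := by linarith [Real.one_le_cosh (κ * slen n (bsrc b) (btgt b))]
    have h1 : (Real.cosh (κ * slen n (bsrc b) (btgt b)) - 1) * F (btgt b) ≤ κ ^ 2 * H (btgt b) := by
      calc (Real.cosh (κ * slen n (bsrc b) (btgt b)) - 1) * F (btgt b) ≤ κ ^ 2 * ((n (btgt b) : ℝ) ^ 2)⁻¹ * F (btgt b) :=
            mul_le_mul_of_nonneg_right (cosh_step_sub_one_le hn hκ0 hκ1 _ _) (hF _)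
        _ = κ ^ 2 * H (btgt b) := by rw [hH]; ring
    have h2 : (Real.cosh (κ * slen n (bsrc b) (btgt b)) - 1) * F (bsrc b) ≤ κ ^ 2 * H (bsrc b) := by
      have h := cosh_step_sub_one_le hn hκ0 hκ1 (btgt b) (bsrc b)
      rw [slen_comm] at h
      calc (Real.cosh (κ * slen n (bsrc b) (btgt b)) - 1) * F (bsrc b) ≤ κ ^ 2 * ((n (bsrc b) : ℝ) ^ 2)⁻¹ * F (bsrc b) :=
            mul_le_mul_of_nonneg_right h (hF _)
        _ = κ ^ 2 * H (bsrc b) := by rw [hH]; ring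
    calc c b ^ 2 * (Real.cosh (κ * slen n (bsrc b) (btgt b)) - 1) * (F (btgt b) + F (bsrc b))
        = c b ^ 2 * ((Real.cosh (κ * slen n (bsrc b) (btgt b)) - 1) * F (btgt b) +
            (Real.cosh (κ * slen n (bsrc b) (btgt b)) - 1) * F (bsrc b)) := by ring
      _ ≤ cmax ^ 2 * (κ ^ 2 * H (btgt b) + κ ^ 2 * H (bsrc b)) :=
          mul_le_mul (hc2 b) (add_le_add h1 h2) (add_nonneg (mul_nonneg hch0 (hF _)) (mul_nonneg hch0 (hF _))) (sq_nonneg _)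
      _ = cmax ^ 2 * κ ^ 2 * (H (btgt b) + H (bsrc b)) := by ring
  have htgt := sum_comp_le_of_card_fiber_le btgt card_filter_btgt_le H hH0
  have hsrc := sum_comp_le_of_card_fiber_le bsrc card_filter_bsrc_le H hH0
  calc ∑ b, c b ^ 2 * (Real.cosh (κ * slen n (bsrc b) (btgt b)) - 1) * (F (btgt b) + F (bsrc b))
      ≤ ∑ b, cmax ^ 2 * κ ^ 2 * (H (btgt b) + H (bsrc b)) := Finset.sum_le_sum fun b _ => hterm b
    _ = cmax ^ 2 * κ ^ 2 * (∑ b, H (btgt b) + ∑ b, H (bsrc b)) := by rw [← Finset.mul_sum, Finset.sum_add_distrib]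
    _ ≤ cmax ^ 2 * κ ^ 2 * (d * ∑ x, H x + d * ∑ x, H x) :=
        mul_le_mul_of_nonneg_left (add_le_add htgt hsrc) (mul_nonneg (sq_nonneg _) (sq_nonneg _))
    _ = 2 * d * cmax ^ 2 * κ ^ 2 * ∑ x, ((n x : ℝ) ^ 2)⁻¹ * F x := by rw [hH]; ring

end Bond

/-! ## §3 The averaging budget on the local scale -/

section Avg

variable {M : ℕ}

omit [Fintype Cp] [DecidableEq Cp] [Fintype J] [Fintype K] in
/-- A corner-labelled block of side `M` has at most `M^d` sites. [folklore] -/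
theorem card_block_le (hM : 1 ≤ M) (hdiv : ∀ i, M ∣ N i) (β : UT N) :
    (univ.filter fun x : UT N => ctrU N M (tblk hM hdiv x) = β).card ≤ M ^ d := by
  classical
  by_cases hβ : ∃ x₀, ctrU N M (tblk hM hdiv x₀) = β
  · obtain ⟨x₀, hx₀⟩ := hβ
    have hsub : (univ.filter fun x : UT N => ctrU N M (tblk hM hdiv x) = β) ⊆
        Finset.univ.image (cubePt hM hdiv (tblk hM hdiv x₀)) := by
      intro x hx
      have hx' : tblk hM hdiv x = tblk hM hdiv x₀ :=
        ctrU_injective hM (((mem_filter.mp hx).2).trans hx₀.symm)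
      obtain ⟨v, hv⟩ := (tblk_eq_iff hM hdiv x (tblk hM hdiv x₀)).mp hx'
      exact Finset.mem_image.mpr ⟨v, mem_univ _, hv⟩
    calc (univ.filter fun x : UT N => ctrU N M (tblk hM hdiv x) = β).card
        ≤ (Finset.univ.image (cubePt hM hdiv (tblk hM hdiv x₀))).card := Finset.card_le_card hsub
      _ ≤ (Finset.univ : Finset (Box d M)).card := Finset.card_image_le
      _ = M ^ d := by simp [Box]
  · have hempty : (univ.filter fun x : UT N => ctrU N M (tblk hM hdiv x) = β) = ∅ := by
      refine Finset.filter_eq_empty_iff.mpr fun x _ hx => hβ ⟨x, hx⟩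
    rw [hempty, Finset.card_empty]
    exact Nat.zero_le _

variable [NeZero d]

omit [Fintype K] in
/-- **THE AVERAGING BUDGET**.  Weights `W_l(x) = ω_l(corner_l x)` supported on the level-`l` cells of a disjoint covering family
(`hsupp`), print-size from above (`a_lω_l²S_l^d ≤ a_max/S_l²`), the weight `φ = κ·d_n(·, y)` (`n` = site scale of the family): for the
blockwise budgets `Θ_l(β)` = `κ·2d(S_l − 1)/S_l` on supported blocks (else a global bound), `w_l(β) = |ω_l(β)|`, `n_l(β) = S_l^d`:
`Σ_l a_l·Σ_β w_l(β)²(e^{Θ_l(β)} − 1)n_l(β)Σ_{x∈β}F(x) ≤ a_max(e^{2dκ} − 1)·Σ_x n(x)⁻²F(x)`, `F ≥ 0` — at most ONE supported level per site.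
[cite: Balaban1985BackgroundPropagators, (3.24) p.394 + Thm 3.1 (3.42) p.397] -/
theorem avg_budget_le (hdisj : ∀ k k' v v', cellPt S hS hdivS lvl zc k v = cellPt S hS hdivS lvl zc k' v' → k = k')
    (hcover : ∀ x : UT N, ∃ k, ∃ v : Box d (S (lvl k)), cellPt S hS hdivS lvl zc k v = x)
    (a : J → ℝ) (ω : J → UT N → ℝ)
    (hsupp : ∀ l x, ω l (ctrU N (S l) (tblk (hS l) (hdivS l) x)) ≠ 0 → ∃ k v, lvl k = l ∧ cellPt S hS hdivS lvl zc k v = x)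
    {amax : ℝ} (hamax : 0 ≤ amax)
    (hscale : ∀ k, a (lvl k) * ω (lvl k) (ctrU N (S (lvl k)) (zc k)) ^ 2 * (S (lvl k) : ℝ) ^ d ≤ amax / (S (lvl k) : ℝ) ^ 2)
    {κ : ℝ} (hκ0 : 0 ≤ κ) (y : UT N) (Θ : J → UT N → ℝ)
    (hΘ : ∀ l β, (∀ x x', ctrU N (S l) (tblk (hS l) (hdivS l) x) = β → ctrU N (S l) (tblk (hS l) (hdivS l) x') = β →
        |κ * sdist bsrc btgt (siteScale S hS hdivS lvl zc hcover) x y - κ * sdist bsrc btgt (siteScale S hS hdivS lvl zc hcover) x' y|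
          ≤ κ * (2 * ((d * (S l - 1) : ℕ) : ℝ) * (S l : ℝ)⁻¹)) → Θ l β = κ * (2 * ((d * (S l - 1) : ℕ) : ℝ) * (S l : ℝ)⁻¹))
    (F : UT N → ℝ) (hF : ∀ x, 0 ≤ F x) :
    ∑ l, a l * ∑ β, |ω l β| ^ 2 * (Real.exp (Θ l β) - 1) * (S l ^ d : ℕ) *
        ∑ x ∈ univ.filter (fun x => ctrU N (S l) (tblk (hS l) (hdivS l) x) = β), F x ≤
      amax * (Real.exp (2 * d * κ) - 1) * ∑ x, ((siteScale S hS hdivS lvl zc hcover x : ℝ) ^ 2)⁻¹ * F x := by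
  classical
  set n := siteScale S hS hdivS lvl zc hcover with hn
  -- the indicator of the supported levels at a site
  set χ : J → UT N → ℝ := fun l x => if ω l (ctrU N (S l) (tblk (hS l) (hdivS l) x)) ≠ 0 then 1 else 0 with hχ
  have hχ0 : ∀ l x, 0 ≤ χ l x := fun l x => by rw [hχ]; simp only; split_ifs <;> norm_num
  have hE0 : 0 ≤ Real.exp (2 * d * κ) - 1 := by
    have : 0 ≤ 2 * (d : ℝ) * κ := by positivity
    linarith [Real.one_le_exp_iff.mpr this]
  -- at most one supported level per site
  have hχ1 : ∀ x, ∑ l, χ l x ≤ 1 := by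
    intro x
    have hsub : (univ.filter fun l => ω l (ctrU N (S l) (tblk (hS l) (hdivS l) x)) ≠ 0) ⊆
        {lvl (cellOf S hS hdivS lvl zc hcover x)} := by
      intro l hl
      obtain ⟨k, v, hk, hx⟩ := hsupp l x (mem_filter.mp hl).2
      rw [Finset.mem_singleton, ← hk, ← hx, cellOf_cellPt S hS hdivS lvl zc hdisj hcover]
    calc ∑ l, χ l x = ∑ l ∈ univ.filter (fun l => ω l (ctrU N (S l) (tblk (hS l) (hdivS l) x)) ≠ 0), (1 : ℝ) := by
          rw [Finset.sum_filter]
      _ = ((univ.filter fun l => ω l (ctrU N (S l) (tblk (hS l) (hdivS l) x)) ≠ 0).card : ℝ) := by simp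
      _ ≤ (({lvl (cellOf S hS hdivS lvl zc hcover x)} : Finset J).card : ℝ) := by exact_mod_cast Finset.card_le_card hsub
      _ = 1 := by simp
  -- the blockwise bound
  have hblk : ∀ l β, a l * (|ω l β| ^ 2 * (Real.exp (Θ l β) - 1) * (S l ^ d : ℕ) *
      ∑ x ∈ univ.filter (fun x => ctrU N (S l) (tblk (hS l) (hdivS l) x) = β), F x) ≤
      amax * (Real.exp (2 * d * κ) - 1) *
        ∑ x ∈ univ.filter (fun x => ctrU N (S l) (tblk (hS l) (hdivS l) x) = β), χ l x * (((n x : ℝ) ^ 2)⁻¹ * F x) := by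
    intro l β
    have hR0 : 0 ≤ amax * (Real.exp (2 * d * κ) - 1) *
        ∑ x ∈ univ.filter (fun x => ctrU N (S l) (tblk (hS l) (hdivS l) x) = β), χ l x * (((n x : ℝ) ^ 2)⁻¹ * F x) :=
      mul_nonneg (mul_nonneg hamax hE0) (sum_nonneg fun x _ =>
        mul_nonneg (hχ0 l x) (mul_nonneg (inv_nonneg.mpr (sq_nonneg _)) (hF x)))
    by_cases hω : ω l β = 0
    · rw [hω, abs_zero, zero_pow two_ne_zero, zero_mul, zero_mul, zero_mul, mul_zero]
      exact hR0
    by_cases hne : ∃ x₀, ctrU N (S l) (tblk (hS l) (hdivS l) x₀) = β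
    swap
    · have hempty : (univ.filter fun x => ctrU N (S l) (tblk (hS l) (hdivS l) x) = β) = ∅ :=
        Finset.filter_eq_empty_iff.mpr fun x _ hx => hne ⟨x, hx⟩
      rw [hempty, Finset.sum_empty, Finset.sum_empty, mul_zero, mul_zero, mul_zero]
    obtain ⟨x₀, hx₀⟩ := hne
    have hω₀ : ω l (ctrU N (S l) (tblk (hS l) (hdivS l) x₀)) ≠ 0 := by rw [hx₀]; exact hω
    obtain ⟨k, v₀, hk, hxk⟩ := hsupp l x₀ hω₀
    subst hk
    -- the cell `k` IS the block `β`
    have hzc : tblk (hS (lvl k)) (hdivS (lvl k)) x₀ = zc k := by rw [← hxk]; exact tblk_cubePt _ _ (zc k) v₀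
    have hβ : β = ctrU N (S (lvl k)) (zc k) := by rw [← hx₀, hzc]
    -- every site of the block has scale `S (lvl k)` and indicator `1`
    have hscaleS : ∀ x, tblk (hS (lvl k)) (hdivS (lvl k)) x = zc k → n x = S (lvl k) := by
      intro x hx
      have hωx : ω (lvl k) (ctrU N (S (lvl k)) (tblk (hS (lvl k)) (hdivS (lvl k)) x)) ≠ 0 := by rw [hx, ← hβ]; exact hω
      obtain ⟨k', v', hk', hx'⟩ := hsupp (lvl k) x hωx
      rw [hn, ← hx', siteScale_cellPt S hS hdivS lvl zc hdisj hcover, hk']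
    have hmem : ∀ x, x ∈ univ.filter (fun x => ctrU N (S (lvl k)) (tblk (hS (lvl k)) (hdivS (lvl k)) x) = β) →
        tblk (hS (lvl k)) (hdivS (lvl k)) x = zc k := fun x hx =>
      ctrU_injective (hS (lvl k)) (((mem_filter.mp hx).2).trans hβ)
    -- the oscillation clause holds on this block: Θ = κ·2d(S−1)/S ≤ 2dκ
    have hP : ∀ x x', ctrU N (S (lvl k)) (tblk (hS (lvl k)) (hdivS (lvl k)) x) = β →
        ctrU N (S (lvl k)) (tblk (hS (lvl k)) (hdivS (lvl k)) x') = β →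
        |κ * sdist bsrc btgt n x y - κ * sdist bsrc btgt n x' y| ≤
          κ * (2 * ((d * (S (lvl k) - 1) : ℕ) : ℝ) * (S (lvl k) : ℝ)⁻¹) := by
      intro x x' hx hx'
      have hxz : tblk (hS (lvl k)) (hdivS (lvl k)) x = zc k := ctrU_injective (hS (lvl k)) (hx.trans hβ)
      have hxz' : tblk (hS (lvl k)) (hdivS (lvl k)) x' = zc k := ctrU_injective (hS (lvl k)) (hx'.trans hβ)
      have h := abs_sdist_sub_sdist_le_of_blk bsrc btgt n (torusComb (hS (lvl k)) (hdivS (lvl k))) (β := zc k)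
        (S := S (lvl k)) (D := d * (S (lvl k) - 1)) (fun x hx => hscaleS x hx) (fun x _ => tdepth_le (hS (lvl k)) x) y hxz hxz'
      rw [← mul_sub, abs_mul, abs_of_nonneg hκ0]
      exact mul_le_mul_of_nonneg_left h hκ0
    have hΘβ : Θ (lvl k) β = κ * (2 * ((d * (S (lvl k) - 1) : ℕ) : ℝ) * (S (lvl k) : ℝ)⁻¹) := hΘ (lvl k) β hP
    have hΘle : Real.exp (Θ (lvl k) β) - 1 ≤ Real.exp (2 * d * κ) - 1 := by
      rw [hΘβ]
      have hS1 : (1 : ℝ) ≤ S (lvl k) := by exact_mod_cast hS (lvl k)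
      have hfrac : ((d * (S (lvl k) - 1) : ℕ) : ℝ) * (S (lvl k) : ℝ)⁻¹ ≤ d := by
        have hsub : ((d * (S (lvl k) - 1) : ℕ) : ℝ) ≤ d * (S (lvl k) : ℝ) := by
          have : d * (S (lvl k) - 1) ≤ d * S (lvl k) := Nat.mul_le_mul_left d (Nat.sub_le _ _)
          exact_mod_cast this
        calc ((d * (S (lvl k) - 1) : ℕ) : ℝ) * (S (lvl k) : ℝ)⁻¹ ≤ d * (S (lvl k) : ℝ) * (S (lvl k) : ℝ)⁻¹ :=
              mul_le_mul_of_nonneg_right hsub (inv_nonneg.mpr (by positivity))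
          _ = d := by field_simp
      have : κ * (2 * ((d * (S (lvl k) - 1) : ℕ) : ℝ) * (S (lvl k) : ℝ)⁻¹) ≤ 2 * d * κ := by nlinarith
      linarith [Real.exp_le_exp.mpr this]
    -- the print-size weight
    have hw : a (lvl k) * (|ω (lvl k) β| ^ 2 * (S (lvl k) ^ d : ℕ)) ≤ amax * ((S (lvl k) : ℝ) ^ 2)⁻¹ := by
      rw [sq_abs, hβ, Nat.cast_pow, ← mul_assoc, ← div_eq_mul_inv]
      exact hscale k
    -- assemble on the block
    have hsumF0 : 0 ≤ ∑ x ∈ univ.filter (fun x => ctrU N (S (lvl k)) (tblk (hS (lvl k)) (hdivS (lvl k)) x) = β), F x :=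
      sum_nonneg fun x _ => hF x
    have hrhs : ∑ x ∈ univ.filter (fun x => ctrU N (S (lvl k)) (tblk (hS (lvl k)) (hdivS (lvl k)) x) = β),
        χ (lvl k) x * (((n x : ℝ) ^ 2)⁻¹ * F x) =
        ((S (lvl k) : ℝ) ^ 2)⁻¹ * ∑ x ∈ univ.filter (fun x => ctrU N (S (lvl k)) (tblk (hS (lvl k)) (hdivS (lvl k)) x) = β), F x := by
      rw [Finset.mul_sum]
      refine Finset.sum_congr rfl fun x hx => ?_
      have hχx : χ (lvl k) x = 1 := by
        rw [hχ]
        simp only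
        rw [if_pos]
        rw [(mem_filter.mp hx).2]
        exact hω
      rw [hχx, one_mul, hscaleS x (hmem x hx)]
    rw [hrhs]
    calc a (lvl k) * (|ω (lvl k) β| ^ 2 * (Real.exp (Θ (lvl k) β) - 1) * (S (lvl k) ^ d : ℕ) *
          ∑ x ∈ univ.filter (fun x => ctrU N (S (lvl k)) (tblk (hS (lvl k)) (hdivS (lvl k)) x) = β), F x)
        = a (lvl k) * (|ω (lvl k) β| ^ 2 * (S (lvl k) ^ d : ℕ)) * ((Real.exp (Θ (lvl k) β) - 1) *
          ∑ x ∈ univ.filter (fun x => ctrU N (S (lvl k)) (tblk (hS (lvl k)) (hdivS (lvl k)) x) = β), F x) := by ring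
      _ ≤ amax * ((S (lvl k) : ℝ) ^ 2)⁻¹ * ((Real.exp (2 * d * κ) - 1) *
          ∑ x ∈ univ.filter (fun x => ctrU N (S (lvl k)) (tblk (hS (lvl k)) (hdivS (lvl k)) x) = β), F x) := by
          refine mul_le_mul hw (mul_le_mul_of_nonneg_right hΘle hsumF0) ?_ (mul_nonneg hamax (inv_nonneg.mpr (sq_nonneg _)))
          refine mul_nonneg ?_ hsumF0
          have hΘ0 : 0 ≤ Θ (lvl k) β := by rw [hΘβ]; positivity
          linarith [Real.one_le_exp_iff.mpr hΘ0]
      _ = amax * (Real.exp (2 * d * κ) - 1) * (((S (lvl k) : ℝ) ^ 2)⁻¹ *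
          ∑ x ∈ univ.filter (fun x => ctrU N (S (lvl k)) (tblk (hS (lvl k)) (hdivS (lvl k)) x) = β), F x) := by ring
  -- sum over blocks and levels
  calc ∑ l, a l * ∑ β, |ω l β| ^ 2 * (Real.exp (Θ l β) - 1) * (S l ^ d : ℕ) *
          ∑ x ∈ univ.filter (fun x => ctrU N (S l) (tblk (hS l) (hdivS l) x) = β), F x
      = ∑ l, ∑ β, a l * (|ω l β| ^ 2 * (Real.exp (Θ l β) - 1) * (S l ^ d : ℕ) *
          ∑ x ∈ univ.filter (fun x => ctrU N (S l) (tblk (hS l) (hdivS l) x) = β), F x) := by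
        refine Finset.sum_congr rfl fun l _ => ?_
        rw [Finset.mul_sum]
    _ ≤ ∑ l, ∑ β, amax * (Real.exp (2 * d * κ) - 1) *
          ∑ x ∈ univ.filter (fun x => ctrU N (S l) (tblk (hS l) (hdivS l) x) = β), χ l x * (((n x : ℝ) ^ 2)⁻¹ * F x) :=
        Finset.sum_le_sum fun l _ => Finset.sum_le_sum fun β _ => hblk l β
    _ = amax * (Real.exp (2 * d * κ) - 1) * ∑ l, ∑ x, χ l x * (((n x : ℝ) ^ 2)⁻¹ * F x) := by
        rw [Finset.mul_sum]
        refine Finset.sum_congr rfl fun l _ => ?_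
        rw [← Finset.mul_sum, Finset.sum_fiberwise_of_maps_to (s := univ) (t := univ)
          (g := fun x => ctrU N (S l) (tblk (hS l) (hdivS l) x)) (fun x _ => mem_univ _)]
    _ = amax * (Real.exp (2 * d * κ) - 1) * ∑ x, (∑ l, χ l x) * (((n x : ℝ) ^ 2)⁻¹ * F x) := by
        rw [Finset.sum_comm]
        refine congrArg _ (Finset.sum_congr rfl fun x _ => ?_)
        rw [Finset.sum_mul]
    _ ≤ amax * (Real.exp (2 * d * κ) - 1) * ∑ x, ((n x : ℝ) ^ 2)⁻¹ * F x := by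
        refine mul_le_mul_of_nonneg_left (Finset.sum_le_sum fun x _ => ?_) (mul_nonneg hamax hE0)
        have h0 : 0 ≤ ((n x : ℝ) ^ 2)⁻¹ * F x := mul_nonneg (inv_nonneg.mpr (sq_nonneg _)) (hF x)
        calc (∑ l, χ l x) * (((n x : ℝ) ^ 2)⁻¹ * F x) ≤ 1 * (((n x : ℝ) ^ 2)⁻¹ * F x) :=
              mul_le_mul_of_nonneg_right (hχ1 x) h0
          _ = _ := one_mul _

end Avg

end

end Summit.QuantumFields.BalabanUV.Beta.MultiscaleDecayBudget
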